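import Literature.MathematicalPhysics.QuantumFieldTheory.Balaban1983to89.B13ExpansionAnalytic

/-!
# `Balaban1983to89.B13JointWalkExpansion` — T. Bałaban, *Renormalization group approach to lattice gauge field
theories. II. Cluster expansions*, Commun. Math. Phys. **116** (1988) 1–22 [Balaban1988RG2Cluster], p. 13 ∕ p. 15 with
[B9] = CMP **99** (1985) Thm 3.10 p. 416: THE WALK-EXPANSION OBJECT of one kernel family `K(σ,u)` on σ-polydisc ×
(𝐔,𝐉)-ball as ONE NAMED HYPOTHESIS SHAPE `JointWalkExpansion` (the eight per-family object binders `hK• hT•a hmaj• hsum•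
hindep• hthr• hA• hD•` of `B13ExpansionAnalytic.differences216_of_walks` as fields: entrywise `HasSum`, termwise
analyticity in the configuration, (1.11)∕(3.108)-shape per-term bounds uniform on polydisc × ball, reduced-rate
`MajSumLe` by `K̄e^{−κd₁}`, the s-monomial structure at the reference configuration, non-negativity) and the covariance's
weaker triple `WalkMajorants`, with their PROJECTIONS BY NAME onto the tree's capstone inputs (`.sigmaThroughWalks`,
`.majorants`, `.sub_ref_sigma`, `.analyticOnBall`), monotonicity in the constants, and non-vacuity

statement-level skeleton of published theorems with citation tags; proofs where landed; nothing here is a claim about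
the Yang–Mills mass gap

PROVENANCE.  Cell `pub-balaban-gaps`, track G1, row (D4) NODE O ∕ A.4: §1 and §4 of planner seat g1-plan-1's (lens
analytic ∕ RG bookkeeping) lean-checked skeleton #6 `HOME/g1/skeletons/D4NodeOWalkTarget.lean` v1.1 sha16 eb080c5cc7c2f19a
(gen 9, 2026-08-23; reading copy over prover seat g1-p2's landed `B13SigmaThroughWalks` p346614 ∕ `B13ExpansionAnalytic`
p347598), FILED by g1-p2 gen 3 on the planner's first-refusal offer [G1-PLAN1-G9-SKELETON-6] («adopt ∕ rename ∕ ignore»):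
declarations byte-identical to the skeleton except (i) namespace `Summit.QuantumFields.BalabanUV.Gaps.D4NodeOWalkTarget` →
this Literature namespace (the objects are hypothesis SHAPES about published expansions, D-0026, not summit statements),
(ii) the split into two files (≤ 400 lines; §2–§3 = `B13TermWalkData`), (iii) provenance tags (`[folklore]` on public
declarations replaced by the printed locus they serve; one helper made `private`).

CITATION HEADER (verbatim, render-checked by g1-p2 gen 3 and lit-balaban r10 g32, see `B13SigmaThroughWalks`): [II] p. 13
*"For this class of localization domains we construct the generalized random walk expansions. This construction was
discussed in [13] for all operators determining Δ_k, and for C^{(k)}(Z₀), but not for (C^{(k)})^{1/2}. … This yields an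
expansion of the integral above, hence an expansion of (C^{(k)})^{1/2} also."*; p. 15 *"The quadratic forms and
covariances in H(Z) are analytic functions on the space of configurations (U, J) satisfying the conditions I.(i)–(iii)
on the domain Z, with constants α′₀, α′₁ much bigger than α₀, α₁"*; [B9] p. 416 (3.107)–(3.108) and *"A term in this
expansion, corresponding to a walk ω, depends on configuration U restricted to X̃₀⁵ ∪ X̃₁⁵ ∪ … ∪ X̃ₙ⁵ … From (3.108) it
follows that the expansion (3.107) is convergent"*.

WHAT IS IN THE TREE (g1-p2, by name).  For ONE (2.14)-term `t = (𝐃, P)` of `H(Z)` on one torus,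
`B13SigmaThroughWalks.differences216_of_walks_two` (p346614 ✓ 97655b456a3d) gives `Differences216` (L16a) from the
OBJECT-level σ-structure `SigmaThroughWalks` of the σ-sections at the reference configuration + (T3b) binders, and
`B13ExpansionAnalytic.differences216_of_walks` (p347598 ✓ 760b19468081) discharges the (T3b) binders from TERMWISE
analyticity of the same joint expansions; `majorant_torus_of_hasSum` + `B13PrimitiveKernels216.localisation17a_of_majorants`
give `Localisation17a` (L17a).  Downstream, unchanged: `B13PrimitiveKernels216Reduced.h226_torus_of_two` →
`B13Lemma3TorusTerms.hrep_of_termwise` → Lemma 3 (2.38) → the cell's NODE A of row (D4).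

WHAT THIS FILE TYPES.
§1 `JointWalkExpansion` — ONE named object per kernel family `K(σ,u)` (rows `p`, columns `n` located on the site torus):
   the fields listed above; `WalkMajorants` — the covariance's weaker triple `hKC hmajC hsumC` (expansion + uniform
   per-term bounds + full-rate `MajSumLe`; no analyticity, no σ-structure — the covariance's σ-difference is DERIVED by the
   resolvent identity).  Projections BY NAME: `JointWalkExpansion.sigmaThroughWalks` (the tree's `SigmaThroughWalks` at
   `u = 0`), `.majSum_full`, `.majorants` (= `majorant_torus_of_hasSum`), `.sub_ref_sigma` (= `sub_ref_entry_le_torus`),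
   `.analyticOnBall` (= `differentiableOn_torus_of_hasSum`), `.mono` (the envelope step: smaller ball ∕ drop ∕ rate,
   larger constant); `WalkMajorants.majorants`, `.mono`.
§4 `jointWalkExpansion_const` — non-vacuity at a constant kernel (`W = Unit`, `SX = ∅`; the degenerate printed case
   `m = 0` for every term).
RATE LEDGER (plan-1, ROUTES-PLAN-1 §2 note 17): walk rate `ρ` → reduced `ρ − ε` (field `majSum`, torus rate `κ`) →
`Localisation17a` at `κ` and `Differences216` at `κ″ < κ′ < κ` (`B13TermWalkData` §2) → `h226_torus_of_two`'s `κ₁ := κ″`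
(`localisation17a_mono_rate`): five drops below the walk rate in total, all O(δ₀); a uniform package must carry the TOP rate.
HONEST FRAMING: interface typing + bookkeeping over EXISTING tree declarations; NOTHING of Bałaban's is asserted beyond
print; every printed estimate ∕ structure appears as a NAMED HYPOTHESIS SHAPE, never as an axiom and never as a theorem
about Bałaban's operators; NO `sorry`, no new named fact.  (D4) is NOT discharged here (instance 0∕1); NOT B12 Thm 2, NOT
`BetaPertH`, NOT continuum ∕ ℝ⁴, NOT infinite volume, NOT mass gap, NOT Clay.  HONEST DEPENDENCY (cell pub-balaban,
verbatim): continuum YM on T⁴ ⇐ BetaPertH ∧ nine spine estimates (0∕9 proved); BetaPertH ⇐ (D1) ∧ (D4) ∧ CAP+tail.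
-/

noncomputable section

namespace Literature.MathematicalPhysics.QuantumFieldTheory.Balaban1983to89.B13JointWalkExpansion

open Metric Set Matrix Finset
open Literature.MathematicalPhysics.QuantumFieldTheory.Balaban1983to89
open Literature.MathematicalPhysics.QuantumFieldTheory.Balaban1983to89.B9SectDWalk (Through MajSumLe)
open Literature.MathematicalPhysics.QuantumFieldTheory.Balaban1983to89.B9Thm34Ext (toB6)
open Literature.MathematicalPhysics.QuantumFieldTheory.Balaban1983to89.B9Thm37GlueTorus (torusGeom tdist1 tdist1_nonneg)
open Literature.MathematicalPhysics.QuantumFieldTheory.Balaban1983to89.TreeLengthTorus (TPt)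
open Literature.MathematicalPhysics.QuantumFieldTheory.Balaban1983to89.B5TorusCover (UT)
open Literature.MathematicalPhysics.QuantumFieldTheory.Balaban1983to89.B13PrimitiveKernels216
  (Localisation17a Differences216 localisation17a_of_majorants)
open Literature.MathematicalPhysics.QuantumFieldTheory.Balaban1983to89.B13SigmaThroughWalks
  (SigmaThroughWalks sub_ref_entry_le_torus majorant_torus_of_hasSum differences216_of_walks_two)
open Literature.MathematicalPhysics.QuantumFieldTheory.Balaban1983to89.B13ExpansionAnalytic
  (differentiableOn_torus_of_hasSum differences216_of_walks)


/-! ## §1. The object: ONE joint generalized random walk expansion of a kernel family on polydisc × ball -/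

section Object

variable {d N' : ℕ} {ν : ℕ} {Nf : Fin ν → ℕ} [∀ i, NeZero (Nf i)]
variable {p n : Type}
variable {E : Type*} [NormedAddCommGroup E] [NormedSpace ℂ E]

/-- **JOINT WALK EXPANSION of a kernel family `K(σ,u)`** (named hypothesis shape, OBJECT level; the eight per-family
binders `hK• hT•a hmaj• hsum• hindep• hthr• hA• hD•` of `B13ExpansionAnalytic.differences216_of_walks` (p347598) as the
fields of ONE structure; typed by g1-plan-1, skeleton #6).  Rows `p`, columns `n` located on the site torus `UT Nf` by `locp`, `locn`; σ on the
polydisc `‖σ_j‖ ≤ e^{κ₁}`; `u` in the `R`-ball of the configuration space `E` (print p. 15: the bigger analyticity space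
with constants `α′₀, α′₁`); terms `T_ω`, σ-carrying sub-family `SX`, amplitudes `A_ω ≥ 0`, walk distances `D_ω ≥ 0`,
walk rate `ρ`, rate drop `ε`, torus rate `κ`, majorant constant `K̄`, σ-region `X`:
* `hasSum` — `K(σ,u)(i,j) = Σ_ω T_ω(σ,u)(i,j)` on polydisc × ball ([B9] Thm 3.10 ∕ (3.107));
* `termAnalytic` — each term is complex differentiable in `u` on the ball ([B9] Thm 3.10: a term is a finite product of
  local operators, a function of the configuration on `X̃₀⁵ ∪ … ∪ X̃ₙ⁵`; [II] p. 15);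
* `maj` — `‖T_ω(σ,u)(i,j)‖ ≤ A_ω e^{−ρD_ω(loc i, loc j)}` UNIFORMLY on polydisc × ball ((3.108) ∕ (1.11), `e^{mκ₁}` absorbed);
* `majSum` — the reduced-rate majorants have partial sums `≤ K̄e^{−κd₁(a,b)}` (`MajSumLe`; (3.108) summed, (3.154));
* `indep`, `through` — at the reference configuration `u = 0`: a term outside `SX` takes its `σ = 0` value, and a
  σ-carrying walk distance passes THROUGH `X` (print p. 13: the parameters sit on the cubes of `σ₀` outside `Z̃₀`);
* `A_nonneg`, `D_nonneg`.
Whether Bałaban's operators `Γ_k(Z₀,σ,𝐔,𝐉)`, `Δ^{(k)}(Z₀,σ,𝐔,𝐉)`, `C^{(k)}(Z₀,σ,𝐔,𝐉)` admit such data — with which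
constants — is NOT asserted: that is §3's statement (cell GAPS G-B9-10, NODE O.2 (v)).
[cite: Balaban1988RG2Cluster, (1.11) p.5, p.13, p.15, (2.16) p.16; Balaban1985BackgroundPropagators, Thm 3.10 p.416] -/
structure JointWalkExpansion (c : B13.Consts) (locp : p → UT Nf) (locn : n → UT Nf)
    (K2 : (TPt d N' → ℂ) → E → Matrix p n ℂ) (X : Finset (UT Nf)) (R ε kap Kbar : ℝ)
    {W : Type} (T2 : W → (TPt d N' → ℂ) → E → Matrix p n ℂ) (SX : Set W) (A : W → ℝ)
    (D : W → UT Nf → UT Nf → ℝ) (ρ : ℝ) : Prop where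
  hasSum : ∀ σ : TPt d N' → ℂ, (∀ j, ‖σ j‖ ≤ Real.exp c.κ₁) → ∀ u ∈ ball (0 : E) R,
    ∀ i j, HasSum (fun ω => T2 ω σ u i j) (K2 σ u i j)
  termAnalytic : ∀ ω, ∀ σ : TPt d N' → ℂ, (∀ j, ‖σ j‖ ≤ Real.exp c.κ₁) →
    ∀ i j, DifferentiableOn ℂ (fun u => T2 ω σ u i j) (ball (0 : E) R)
  maj : ∀ ω, ∀ σ : TPt d N' → ℂ, (∀ j, ‖σ j‖ ≤ Real.exp c.κ₁) → ∀ u ∈ ball (0 : E) R,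
    ∀ i j, ‖T2 ω σ u i j‖ ≤ A ω * Real.exp (-(ρ * D ω (locp i) (locn j)))
  majSum : MajSumLe (g := toB6 (torusGeom Nf 0 0 0) 0 True)
    (fun ω a b => A ω * Real.exp (-((ρ - ε) * D ω a b))) (fun a b => Kbar * Real.exp (-(kap * tdist1 Nf a b)))
  indep : ∀ ω, ω ∉ SX → ∀ σ : TPt d N' → ℂ, (∀ j, ‖σ j‖ ≤ Real.exp c.κ₁) → T2 ω σ 0 = T2 ω 0 0
  through : ∀ ω ∈ SX, Through (toB6 (torusGeom Nf 0 0 0) 0 True) (D ω) (↑X : Set (UT Nf))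
  A_nonneg : ∀ ω, 0 ≤ A ω
  D_nonneg : ∀ ω a b, 0 ≤ D ω a b

/-- **WALK MAJORANTS of a kernel family** (the covariance's weaker triple `hKC hmajC hsumC` of `differences216_of_walks`:
expansion + uniform per-term bounds + a full-rate `MajSumLe` bound; no analyticity, no σ-structure — the covariance's
σ-difference is DERIVED by the resolvent identity, `B13CovarianceDifference216.hdC_of_hdE`).
[cite: Balaban1988RG2Cluster, p.13, p.15; Balaban1985BackgroundPropagators, (3.108) p.416] -/
structure WalkMajorants (c : B13.Consts) (locp : p → UT Nf) (locn : n → UT Nf)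
    (K2 : (TPt d N' → ℂ) → E → Matrix p n ℂ) (R kap Kbar : ℝ)
    {W : Type} (T2 : W → (TPt d N' → ℂ) → E → Matrix p n ℂ) (A : W → ℝ)
    (D : W → UT Nf → UT Nf → ℝ) (ρ : ℝ) : Prop where
  hasSum : ∀ σ : TPt d N' → ℂ, (∀ j, ‖σ j‖ ≤ Real.exp c.κ₁) → ∀ u ∈ ball (0 : E) R,
    ∀ i j, HasSum (fun ω => T2 ω σ u i j) (K2 σ u i j)
  maj : ∀ ω, ∀ σ : TPt d N' → ℂ, (∀ j, ‖σ j‖ ≤ Real.exp c.κ₁) → ∀ u ∈ ball (0 : E) R,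
    ∀ i j, ‖T2 ω σ u i j‖ ≤ A ω * Real.exp (-(ρ * D ω (locp i) (locn j)))
  majSum : MajSumLe (g := toB6 (torusGeom Nf 0 0 0) 0 True)
    (fun ω a b => A ω * Real.exp (-(ρ * D ω a b))) (fun a b => Kbar * Real.exp (-(kap * tdist1 Nf a b)))
  A_nonneg : ∀ ω, 0 ≤ A ω

/-- Termwise domination passes `MajSumLe` to the smaller family (two-liner; `B13ExpansionAnalytic` keeps its copy private). [folklore] -/
private theorem majSumLe_of_le {g : B6.Geometry} {W : Type} {K₁ K₂ : W → g.Site → g.Site → ℝ}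
    {Kbar : g.Site → g.Site → ℝ} (hle : ∀ ω a b, K₁ ω a b ≤ K₂ ω a b) (h : MajSumLe K₂ Kbar) :
    MajSumLe K₁ Kbar :=
  fun S a b => (Finset.sum_le_sum fun ω _ => hle ω a b).trans (h S a b)

variable {c : B13.Consts} {locp : p → UT Nf} {locn : n → UT Nf} {K2 : (TPt d N' → ℂ) → E → Matrix p n ℂ}
variable {X : Finset (UT Nf)} {R ε kap Kbar : ℝ}
variable {W : Type} {T2 : W → (TPt d N' → ℂ) → E → Matrix p n ℂ} {SX : Set W} {A : W → ℝ}
variable {D : W → UT Nf → UT Nf → ℝ} {ρ : ℝ}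

namespace JointWalkExpansion

/-- **Projection 1 — the tree's `SigmaThroughWalks` at the reference configuration** (the packaging step inside
INTENT-14's `differences216_of_walks`, by name): the σ-section `σ ↦ K(σ,0)` with terms `σ ↦ T_ω(σ,0)`.
[cite: Balaban1988RG2Cluster, (1.11) p.5, p.13] -/
theorem sigmaThroughWalks (h : JointWalkExpansion c locp locn K2 X R ε kap Kbar T2 SX A D ρ) (hR : 0 < R) :
    SigmaThroughWalks (toB6 (torusGeom Nf 0 0 0) 0 True) {σ : TPt d N' → ℂ | ∀ j, ‖σ j‖ ≤ Real.exp c.κ₁} 0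
      locp locn (fun σ => K2 σ 0) (fun ω σ => T2 ω σ 0) SX X A D ρ :=
  ⟨fun σ hσ i j => h.hasSum σ hσ 0 (mem_ball_self hR) i j, fun ω hω σ hσ => h.indep ω hω σ hσ, h.through,
    h.A_nonneg, fun ω σ hσ i j => h.maj ω σ hσ 0 (mem_ball_self hR) i j⟩

/-- **Projection 2 — full-rate summability** from the reduced-rate field (`ε ≥ 0`, `A_ω ≥ 0`, `D_ω ≥ 0`): the (3.108)
majorants at the walk rate are below those at the reduced rate. [cite: Balaban1985BackgroundPropagators, (3.108) p.416] -/
theorem majSum_full (h : JointWalkExpansion c locp locn K2 X R ε kap Kbar T2 SX A D ρ) (hε : 0 ≤ ε) :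
    MajSumLe (g := toB6 (torusGeom Nf 0 0 0) 0 True)
      (fun ω a b => A ω * Real.exp (-(ρ * D ω a b))) (fun a b => Kbar * Real.exp (-(kap * tdist1 Nf a b))) :=
  majSumLe_of_le (fun ω a b => mul_le_mul_of_nonneg_left
    (Real.exp_le_exp.2 (by nlinarith [mul_nonneg hε (h.D_nonneg ω a b)])) (h.A_nonneg ω)) h.majSum

/-- **Projection 3 — the uniform torus-localised majorants** `‖K(σ,u)(b,j)‖ ≤ K̄e^{−κd₁(loc b, loc j)}` on polydisc × ball
(= `B13SigmaThroughWalks.majorant_torus_of_hasSum`, the binders `hmΓ hmE hmC` of `differences216_of_walks_two` ∕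
`localisation17a_of_majorants`). [cite: Balaban1988RG2Cluster, p.15, p.13] -/
theorem majorants (h : JointWalkExpansion c locp locn K2 X R ε kap Kbar T2 SX A D ρ) (hε : 0 ≤ ε) :
    ∀ σ : TPt d N' → ℂ, (∀ j, ‖σ j‖ ≤ Real.exp c.κ₁) → ∀ u ∈ ball (0 : E) R,
      ∀ b j, ‖K2 σ u b j‖ ≤ Kbar * Real.exp (-(kap * tdist1 Nf (locp b) (locn j))) :=
  majorant_torus_of_hasSum c locp locn K2 h.A_nonneg h.hasSum h.maj (h.majSum_full hε)

/-- **Projection 4 — the σ-part of (2.16) at the reference configuration** `‖(K(σ,0) − K(0,0))(b,j)‖ ≤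
(2K̄e^{−εR_σ})·e^{−κd₁(loc b, loc j)}` when `d₁(loc b, X) ≥ R_σ` for every row index (= `sub_ref_entry_le_torus`, the
(T3a) binders `hσΓ hσE`). [cite: Balaban1988RG2Cluster, (2.16) p.16, p.13] -/
theorem sub_ref_sigma (h : JointWalkExpansion c locp locn K2 X R ε kap Kbar T2 SX A D ρ) (hR : 0 < R) (hε : 0 ≤ ε)
    {Rσ : ℝ} (hfar : ∀ i : p, ∀ z ∈ X, Rσ ≤ tdist1 Nf (locp i) z) :
    ∀ σ : TPt d N' → ℂ, (∀ j, ‖σ j‖ ≤ Real.exp c.κ₁) →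
      ∀ b j, ‖(K2 σ 0 - K2 0 0) b j‖ ≤
        (2 * Kbar * Real.exp (-(ε * Rσ))) * Real.exp (-(kap * tdist1 Nf (locp b) (locn j))) :=
  sub_ref_entry_le_torus c locp locn (fun σ => K2 σ 0) (h.sigmaThroughWalks hR) hε h.majSum hfar

/-- The analyticity binder shape `haΓ ∕ haE` of `differences216_of_walks_two` for the family.
[cite: Balaban1988RG2Cluster, p.15] -/
def AnalyticOnBall (c : B13.Consts) (K2 : (TPt d N' → ℂ) → E → Matrix p n ℂ) (R : ℝ) : Prop :=
  ∀ σ : TPt d N' → ℂ, (∀ j, ‖σ j‖ ≤ Real.exp c.κ₁) → ∀ b j, DifferentiableOn ℂ (fun u => K2 σ u b j) (ball (0 : E) R)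

/-- **Projection 5 — (T3b) analyticity of the kernel from TERMWISE analyticity** (=
`B13ExpansionAnalytic.differentiableOn_torus_of_hasSum`, p347598, BY NAME: termwise differentiability + Cauchy
estimates + `hasFDerivAt_tsum_of_isPreconnected`; nothing re-proved here). [cite: Balaban1988RG2Cluster, p.15; Balaban1985BackgroundPropagators, Thm 3.10 p.416] -/
theorem analyticOnBall (h : JointWalkExpansion c locp locn K2 X R ε kap Kbar T2 SX A D ρ) (hε : 0 ≤ ε) :
    AnalyticOnBall c K2 R :=
  differentiableOn_torus_of_hasSum c locp locn K2 h.A_nonneg h.hasSum h.termAnalytic h.maj (h.majSum_full hε)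

/-- **Monotonicity in the constant package** (the envelope step of §3): a joint walk expansion on the `R`-ball with
rate drop `ε`, torus rate `κ`, constant `K̄ ≥ 0` is one on any smaller ball `R′ ≤ R`, with any smaller drop `ε′ ≤ ε`
(the reduced-rate majorants only grow with the drop: exponent `ρ − ε′ ≥ ρ − ε`, `D_ω ≥ 0`), any smaller torus rate
`κ′ ≤ κ` and any larger constant `K̄′ ≥ K̄` — same terms, same σ-structure ([B9] Thm 3.10: the constants of (3.108) may
be weakened freely). [cite: Balaban1985BackgroundPropagators, Thm 3.10 p.416] -/
theorem mono (h : JointWalkExpansion c locp locn K2 X R ε kap Kbar T2 SX A D ρ) {R' ε' kap' Kbar' : ℝ}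
    (hR : R' ≤ R) (hε : ε' ≤ ε) (hkap : kap' ≤ kap) (hK : 0 ≤ Kbar) (hKbar : Kbar ≤ Kbar') :
    JointWalkExpansion c locp locn K2 X R' ε' kap' Kbar' T2 SX A D ρ where
  hasSum σ hσ u hu i j := h.hasSum σ hσ u (ball_subset_ball hR hu) i j
  termAnalytic ω σ hσ i j := (h.termAnalytic ω σ hσ i j).mono (ball_subset_ball hR)
  maj ω σ hσ u hu i j := h.maj ω σ hσ u (ball_subset_ball hR hu) i j
  majSum := by
    refine majSumLe_of_le (fun ω a b => ?_) (h.majSum.mono fun a b => ?_)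
    · exact mul_le_mul_of_nonneg_left
        (Real.exp_le_exp.2 (by nlinarith [mul_nonneg (sub_nonneg.2 hε) (h.D_nonneg ω a b)])) (h.A_nonneg ω)
    · exact (mul_le_mul_of_nonneg_left
          (Real.exp_le_exp.2 (by nlinarith [mul_nonneg (sub_nonneg.2 hkap) (tdist1_nonneg a b)])) hK).trans
        (mul_le_mul_of_nonneg_right hKbar (Real.exp_pos _).le)
  indep := h.indep
  through := h.through
  A_nonneg := h.A_nonneg
  D_nonneg := h.D_nonneg

end JointWalkExpansion

namespace WalkMajorants

omit [NormedSpace ℂ E] in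
/-- The uniform majorants of a `WalkMajorants` family (= `majorant_torus_of_hasSum`). [cite: Balaban1988RG2Cluster, p.15] -/
theorem majorants (h : WalkMajorants c locp locn K2 R kap Kbar T2 A D ρ) :
    ∀ σ : TPt d N' → ℂ, (∀ j, ‖σ j‖ ≤ Real.exp c.κ₁) → ∀ u ∈ ball (0 : E) R,
      ∀ b j, ‖K2 σ u b j‖ ≤ Kbar * Real.exp (-(kap * tdist1 Nf (locp b) (locn j))) :=
  majorant_torus_of_hasSum c locp locn K2 h.A_nonneg h.hasSum h.maj h.majSum

omit [NormedSpace ℂ E] in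
/-- Monotonicity in `(R, κ, K̄)` (weakening the constants of (3.108)). [cite: Balaban1985BackgroundPropagators, (3.108) p.416] -/
theorem mono (h : WalkMajorants c locp locn K2 R kap Kbar T2 A D ρ) {R' kap' Kbar' : ℝ}
    (hR : R' ≤ R) (hkap : kap' ≤ kap) (hK : 0 ≤ Kbar) (hKbar : Kbar ≤ Kbar') :
    WalkMajorants c locp locn K2 R' kap' Kbar' T2 A D ρ where
  hasSum σ hσ u hu i j := h.hasSum σ hσ u (ball_subset_ball hR hu) i j
  maj ω σ hσ u hu i j := h.maj ω σ hσ u (ball_subset_ball hR hu) i j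
  majSum := h.majSum.mono fun a b =>
    (mul_le_mul_of_nonneg_left
        (Real.exp_le_exp.2 (by nlinarith [mul_nonneg (sub_nonneg.2 hkap) (tdist1_nonneg a b)])) hK).trans
      (mul_le_mul_of_nonneg_right hKbar (Real.exp_pos _).le)
  A_nonneg := h.A_nonneg

end WalkMajorants

end Object

/-! ## §4. Non-vacuity of the shapes (degenerate printed case `m = 0` for every term: σ- and u-INDEPENDENT kernels) -/

section NonVacuity

variable {d N' : ℕ} {ν : ℕ} {Nf : Fin ν → ℕ} [∀ i, NeZero (Nf i)]
variable {p n : Type}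
variable {E : Type*} [NormedAddCommGroup E] [NormedSpace ℂ E]

/-- A CONSTANT kernel family (`K(σ,u) = K₀`) entrywise bounded by `A₀e^{−ρD₀(loc i, loc j)}` whose one-term majorant is
`MajSumLe`-bounded is its own one-term joint walk expansion with empty σ-carrying sub-family (`W = Unit`, `SX = ∅`) — the
shape is inhabited (cf. the tree's `sigmaThroughWalks_const`); it says nothing about Bałaban's kernels (the degenerate printed
case *"m is the number of the parameters s connected with the walk ω"* `= 0` for every term). [cite: Balaban1988RG2Cluster, (1.11) p.5] -/
theorem jointWalkExpansion_const (c : B13.Consts) (locp : p → UT Nf) (locn : n → UT Nf) (K₀ : Matrix p n ℂ)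
    (X : Finset (UT Nf)) {R ε kap Kbar A₀ ρ : ℝ} (hA₀ : 0 ≤ A₀) {D₀ : UT Nf → UT Nf → ℝ} (hD₀ : ∀ a b, 0 ≤ D₀ a b)
    (hmaj : ∀ i j, ‖K₀ i j‖ ≤ A₀ * Real.exp (-(ρ * D₀ (locp i) (locn j))))
    (hsum : MajSumLe (g := toB6 (torusGeom Nf 0 0 0) 0 True)
      (fun (_ : Unit) a b => A₀ * Real.exp (-((ρ - ε) * D₀ a b))) (fun a b => Kbar * Real.exp (-(kap * tdist1 Nf a b)))) :
    JointWalkExpansion c locp locn (fun (_ : TPt d N' → ℂ) (_ : E) => K₀) X R ε kap Kbar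
      (fun (_ : Unit) (_ : TPt d N' → ℂ) (_ : E) => K₀) (∅ : Set Unit) (fun _ => A₀) (fun _ => D₀) ρ where
  hasSum σ _ u _ i j := by simp
  termAnalytic _ σ _ i j := differentiableOn_const _
  maj _ σ _ u _ i j := hmaj i j
  majSum := hsum
  indep _ _ σ _ := rfl
  through ω hω := by simp at hω
  A_nonneg _ := hA₀
  D_nonneg _ := hD₀

end NonVacuity

end Literature.MathematicalPhysics.QuantumFieldTheory.Balaban1983to89.B13JointWalkExpansion

end
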